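import Summits.CriticalPhenomena.SAWScalingLimit.Theorems.SAWTotalPositivityCriticalBubbleBoundJoinAssembly

/-!
# The two sides of the Madras join have exactly `j + 9` and `m + 9` edges
(crux `SAWTotalPositivity.CriticalBubbleBound`, stmt-CriticalPhenomena-7117; line `docking-census-joining`,
registered helper stub `joinPoly_sides_card` of the macroscopic door, lead prover c7)

For an admissible arrow (`χ¹ ∈ lexRooted j`, `χ² ∈ lexRooted m`, `j, m ≥ 3`, `k ∈ offsets j m χ¹ χ²`),
the modified polygon `τ̃ = modify P(χ¹) Y` has `#P(χ¹) + 8 = j + 9` edges and the partner's rotated-back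
modification translated by the spacer, `σ̂ = (modifyR σ' Y) + (T₂, 0)` with `σ' = P(χ²) + (T*, k)`, has
`#σ' + 8 = m + 9` edges. This is the edge count clause of `modify_uniform` / `sigma_side` (the eight local
cases of Madras' surgery each trade `r` removed edges for `r + 8` added ones), fed with the corridor and
window facts of `contact_window_facts` exactly as in the assembly `joinPoly_spec`. It is the input of the
MACROSCOPIC upgrade of the re-rooted junction corner: both sides of the un-joining flip of the
`(j + m + 18)`-edge join carry at least a quarter of its edges when `j + 17, m + 17` lie in one dyadic block.

Source: A. Hammond, *An upper bound on the number of self-avoiding polygons via joining*, Ann. Probab. 46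
(2018) = arXiv:1808.09032, §4.1 (the modification adds eight edges to each polygon), Lemma 4.12.
-/

noncomputable section

open Literature.Probability.LatticeModels
open Literature.Probability.RandomPlanarGeometry Literature.Probability.RandomPlanarGeometry.SAW
open scoped BigOperators
open Summit.CriticalPhenomena.SAWScalingLimit.Theorems.CriticalBubbleBound.Negative (e₀)
open Summit.CriticalPhenomena.SAWScalingLimit.Theorems.CriticalBubbleBound.Docking

namespace Summit.CriticalPhenomena.SAWScalingLimit.Theorems.CriticalBubbleBound.Join

/-! ## Coordinates -/

/-- Two sites of `ℤ²` with equal coordinates are equal. [folklore] -/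
private theorem site_eq {x y : Site 2} (h0 : x 0 = y 0) (h1 : x 1 = y 1) : x = y :=
  funext (Fin.forall_fin_two.2 ⟨h0, h1⟩)

/-- Coordinates of `x + (s, t)`. [folklore] -/
private theorem vadd_apply (x : Site 2) (s t : ℤ) :
    (x + ![s, t]) 0 = x 0 + s ∧ (x + ![s, t]) 1 = x 1 + t := ⟨rfl, rfl⟩

/-- A vertex in the vertical 3-window of `Y`, given as `Y + (0, t)` with `|t| ≤ 1`. [folklore] -/
private theorem window_of_vadd {V : Finset (Site 2)} {Y : Site 2} {t : ℤ} (h1 : -1 ≤ t) (h2 : t ≤ 1)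
    (h : Y + ![0, t] ∈ V) : Y - e₁ ∈ V ∨ Y ∈ V ∨ Y + e₁ ∈ V := by
  obtain ⟨-, -, k0, k1⟩ := e₀_e₁_apply
  obtain ⟨f0, f1⟩ := vadd_apply Y 0 t
  rcases (by omega : t = -1 ∨ t = 0 ∨ t = 1) with rfl | rfl | rfl
  · refine Or.inl ?_
    convert h using 1
    exact site_eq (by rw [f0, Pi.sub_apply, k0]; omega) (by rw [f1, Pi.sub_apply, k1]; omega)
  · refine Or.inr (Or.inl ?_)
    convert h using 1
    exact site_eq (by rw [f0]; omega) (by rw [f1]; omega)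
  · refine Or.inr (Or.inr ?_)
    convert h using 1
    exact site_eq (by rw [f0, Pi.add_apply, k0]) (by rw [f1, Pi.add_apply, k1])

/-! ## The corridors and windows of the two sides -/

/-- The corridor/window hypotheses of `modify_uniform` (for `τ = P(χ¹)`) and of `sigma_side` (for the
partner `S` at first contact), from the free zones and the window vertices of the contact geometry.
[cite: Hammond2015SAPJoining, §4.1] -/
private theorem corridors {j : ℕ} {χ₁ : ℕ → Site 2} (S : Finset (Sym2 (Site 2))) (Y : Site 2)
    (hF1 : ∀ b : Site 2, IsV S b → ∀ s t : ℤ, 1 ≤ s → -2 ≤ t → t ≤ 2 → b + ![s, t] ∉ verts j χ₁)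
    (hF2 : ∀ a ∈ verts j χ₁, ∀ s t : ℤ, 1 ≤ s → -2 ≤ t → t ≤ 2 → ¬ IsV S (a + ![-s, t]))
    (hwτ : ∃ t : ℤ, -1 ≤ t ∧ t ≤ 1 ∧ Y + ![0, t] ∈ verts j χ₁)
    (hwσ : ∃ t : ℤ, -1 ≤ t ∧ t ≤ 1 ∧ IsV S (Y + ![0, t])) :
    (∀ s t : ℤ, 1 ≤ s → -1 ≤ t → t ≤ 1 → ¬ IsV (pedges j χ₁) (Y + ![s, t])) ∧
      (∀ s t : ℤ, 1 ≤ s → -1 ≤ t → t ≤ 1 → ¬ IsV S (Y + ![-s, t])) ∧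
      (IsV (pedges j χ₁) (Y - e₁) ∨ IsV (pedges j χ₁) Y ∨ IsV (pedges j χ₁) (Y + e₁)) ∧
      (IsV S (Y - e₁) ∨ IsV S Y ∨ IsV S (Y + e₁)) := by
  have hVτ : ∀ x : Site 2, IsV (pedges j χ₁) x ↔ x ∈ verts j χ₁ := fun x => exists_mem_pedges_iff
  obtain ⟨tτ, htτ1, htτ2, haτ⟩ := hwτ
  obtain ⟨tσ, htσ1, htσ2, hbσ⟩ := hwσ
  refine ⟨fun s t hs ht1 ht2 h => ?_, fun s t hs ht1 ht2 h => ?_, ?_, ?_⟩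
  · rw [hVτ] at h
    refine hF1 _ hbσ s (t - tσ) hs (by omega) (by omega) ?_
    convert h using 1
    obtain ⟨f0, f1⟩ := vadd_apply (Y + ![0, tσ]) s (t - tσ)
    obtain ⟨g0, g1⟩ := vadd_apply Y 0 tσ
    obtain ⟨h0, h1⟩ := vadd_apply Y s t
    exact site_eq (by omega) (by omega)
  · refine hF2 _ haτ s (t - tτ) hs (by omega) (by omega) ?_
    convert h using 1
    obtain ⟨f0, f1⟩ := vadd_apply (Y + ![0, tτ]) (-s) (t - tτ)
    obtain ⟨g0, g1⟩ := vadd_apply Y 0 tτ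
    obtain ⟨h0, h1⟩ := vadd_apply Y (-s) t
    exact site_eq (by omega) (by omega)
  · rw [hVτ, hVτ, hVτ]
    exact window_of_vadd htτ1 htτ2 haτ
  · have h := window_of_vadd (V := vxs S) htσ1 htσ2 (mem_vxs.2 hbσ)
    rwa [mem_vxs, mem_vxs, mem_vxs] at h

/-! ## The edge counts -/

/-- **Stub `joinPoly_sides_card`.** For an admissible arrow `(χ¹, χ², k)` the two sides of the
un-joining flip of the Madras join have exactly `j + 9` and `m + 9` edges: the modified polygon
`τ̃ = modify P(χ¹) Y` has `#P(χ¹) + 8` edges (`modify_uniform`) and the partner's rotated-back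
modification translated by the spacer has `#σ' + 8` edges (`sigma_side`), where `#P(χ¹) = j + 1` and
`#σ' = m + 1`. [cite: Hammond2015SAPJoining, Lemma 4.12] -/
theorem joinPoly_sides_card : ∀ (j m : ℕ) (χ₁ χ₂ : ℕ → Site 2) (k : ℤ), χ₁ ∈ lexRooted j → χ₂ ∈ lexRooted m → 3 ≤ j → 3 ≤ m → k ∈ offsets j m χ₁ χ₂ → (modify (pedges j χ₁) (joinY j m χ₁ χ₂ k)).card = j + 9 ∧ (trE ![spacer (caseOf (pedges j χ₁) (joinY j m χ₁ χ₂ k)) (caseR (pedges m (shift (sigmaShift j m χ₁ χ₂ k) χ₂)) (joinY j m χ₁ χ₂ k)), 0] (modifyR (pedges m (shift (sigmaShift j m χ₁ χ₂ k) χ₂)) (joinY j m χ₁ χ₂ k))).card = m + 9 := by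
  intro j m χ₁ χ₂ k hχ₁ hχ₂ hj hm hk
  obtain ⟨-, hF1, hF2, hwτ, ⟨tσ, htσ1, htσ2, hbσ⟩, -, -, -⟩ :=
    contact_window_facts j m χ₁ χ₂ k hχ₁ hχ₂ hj hm hk
  have hsaw₁ := lexRooted_subset j hχ₁
  have hsaw₂ := lexRooted_subset m hχ₂
  have hτP : IsPolygon (zdGraph 2) (pedges j χ₁) := isPolygon_pedges j χ₁ hsaw₁ hj
  have hτc : (pedges j χ₁).card = j + 1 := card_pedges hsaw₁ (by omega)
  obtain ⟨hS, hSc⟩ := pedges_shift_isPolygon hsaw₂ (by omega) (sigmaShift j m χ₁ χ₂ k)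
  have hV : ∀ x : Site 2, IsV (pedges m (shift (sigmaShift j m χ₁ χ₂ k) χ₂)) x ↔
      x ∈ verts m (shift (sigmaShift j m χ₁ χ₂ k) χ₂) := fun x => exists_mem_pedges_iff
  obtain ⟨hcorτ, hcorσ, hwinτ, hwinσ⟩ :=
    corridors (pedges m (shift (sigmaShift j m χ₁ χ₂ k) χ₂)) (joinY j m χ₁ χ₂ k)
      (fun b hb => hF1 b ((hV b).1 hb)) (fun a ha s t hs ht1 ht2 h => hF2 a ha s t hs ht1 ht2 ((hV _).1 h))
      hwτ ⟨tσ, htσ1, htσ2, (hV _).2 hbσ⟩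
  obtain ⟨-, hτ2, -⟩ := modify_uniform (pedges j χ₁) (joinY j m χ₁ χ₂ k) hτP hcorτ hwinτ
  obtain ⟨-, hσ2, -⟩ := sigma_side (pedges m (shift (sigmaShift j m χ₁ χ₂ k) χ₂)) (joinY j m χ₁ χ₂ k)
    (spacer (caseOf (pedges j χ₁) (joinY j m χ₁ χ₂ k))
      (caseR (pedges m (shift (sigmaShift j m χ₁ χ₂ k) χ₂)) (joinY j m χ₁ χ₂ k))) hS hcorσ hwinσ
  refine ⟨by omega, ?_⟩
  change (trE _ (rotE (joinY j m χ₁ χ₂ k) (modify (rotE (joinY j m χ₁ χ₂ k)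
    (pedges m (shift (sigmaShift j m χ₁ χ₂ k) χ₂))) (joinY j m χ₁ χ₂ k)))).card = m + 9
  omega

end Summit.CriticalPhenomena.SAWScalingLimit.Theorems.CriticalBubbleBound.Join

end
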